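import Summits.ValiantsHypothesis.ValiantsHypothesis.Theorems.LacunarySymmetroidMatrixDescartesDoorA26WallBubblingNewtonLift

/-!
# `DoorA26` / line `wall_bubbling` — SECOND-ORDER OPENINGS of a profile of order ≤ 3 (cubic families; touches and triple zeros opened at scale η)

HONEST FRAMING.  Object-search cell `pub-symmetroid`, crux `Theses.LacunarySymmetroid.DoorA26` (stmt-ValiantsHypothesis-19979; OPEN, typed,
never asserted).  W2 seat val-sym-door-p1 g20, file #82; def-free helper for obligation (R) of `Cruxes/DoorA26/Lines/wall_bubbling.lean`.
Imports #79 `…NewtonLift`.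

WHY.  Memo `DOOR-A26-P1G20-NEWTON-LIFT.md` §3: when the first-order system of a profile of order ≤ 3 is obstructed (the |J| = 7 core of g19 §7c–§7e),
the lift must come from a family `S + ηT₁ + η²T₂ + η³T₃` in which every touch PERSISTS at first order (`c₁(z_j) = 0`) and splits at scale `η`
(quadratic `A_jσ² + c₁′(z_j)σ + c₂(z_j)` with two simple real roots), and the triple zero opens at scale `η` through the cubic
`Aσ³ + (c₁″/2)σ² + c₂′σ + c₃` (`c₁ = c₁′ = 0 = c₂` at `t⋆`; three simple real roots); simple zeros persist.  The dual criterion of the memo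
(`Φ(Q₁) > 0 on 𝒩`) produces exactly such `T₁, T₂, T₃`; this file is the kernel format that turns them into `δ ∈ TwentyLocus` — an instance of #79
with `N = 6`, `α_j = 1` (`1/2` at simple zeros), `β_j = m_j`, `k_{j,n} = m_j − n`.

WHAT IS HERE.  `det_add_smul3_fin_two` (the `η`-expansion of `det(A + ηB + η²C + η³D)`), `expPencil_add_smul3`, ★★
`mem_twentyLocus_of_secondOrder_openings` (simple zeros, second-order touches, second-order triple zeros — any number, no frame; the witnesses of the
quadratics / cubics are hypotheses).  Nothing here bears on `DoorA26`, `DoorA34`, (W)/(M)/(R), `MatrixDescartes` (18050) or `VP ≠ VNP`; registers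
unchanged.

[folklore] Newton polygon.  [this work] the theorem.
-/

set_option linter.dupNamespace false

namespace Summit.ValiantsHypothesis.ValiantsHypothesis.Theorems.LacunarySymmetroidMatrixDescartes.WallBubbling

open Finset Filter Topology
open Bubbling (TwentyLocus expSum)

/-- The `η`-expansion of `det(A + ηB + η²C + η³D)` for `2 × 2` matrices (`pol(X,Y) = det(X+Y) − det X − det Y`). [folklore] -/
theorem det_add_smul3_fin_two (A B C D : Matrix (Fin 2) (Fin 2) ℝ) (η : ℝ) :
    (A + η • B + η ^ 2 • C + η ^ 3 • D).det
      = A.det + η * ((A + B).det - A.det - B.det)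
        + η ^ 2 * (((A + C).det - A.det - C.det) + B.det)
        + η ^ 3 * (((A + D).det - A.det - D.det) + ((B + C).det - B.det - C.det))
        + η ^ 4 * (((B + D).det - B.det - D.det) + C.det)
        + η ^ 5 * ((C + D).det - C.det - D.det)
        + η ^ 6 * D.det := by
  simp only [Matrix.det_fin_two, Matrix.add_apply, Matrix.smul_apply, smul_eq_mul]
  ring

/-- The pencil of the family `S + ηT₁ + η²T₂ + η³T₃` is `P + ηQ₁ + η²Q₂ + η³Q₃`. [folklore] -/
theorem expPencil_add_smul3 (δ : Fin 6 → ℝ) (S T₁ T₂ T₃ : Fin 6 → Matrix (Fin 2) (Fin 2) ℝ) (η t : ℝ) :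
    (∑ l, Real.exp (δ l * t) • (S l + η • T₁ l + η ^ 2 • T₂ l + η ^ 3 • T₃ l))
      = (∑ l, Real.exp (δ l * t) • S l) + η • (∑ l, Real.exp (δ l * t) • T₁ l)
        + η ^ 2 • (∑ l, Real.exp (δ l * t) • T₂ l) + η ^ 3 • (∑ l, Real.exp (δ l * t) • T₃ l) := by
  simp only [smul_add, Finset.sum_add_distrib, Finset.smul_sum]
  congr 1
  · congr 1
    · congr 1
      exact Finset.sum_congr rfl fun l _ => by rw [smul_comm]
    · exact Finset.sum_congr rfl fun l _ => by rw [smul_comm]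
  · exact Finset.sum_congr rfl fun l _ => by rw [smul_comm]

/-- ★★ **SECOND-ORDER OPENINGS OF A PROFILE OF ORDER ≤ 3.**  Symmetric letters `S, T₁, T₂, T₃`, pencils `P, Q₁, Q₂, Q₃`, coefficients
`c₀ = det P`, `c₁ = pol(P,Q₁)`, `c₂ = pol(P,Q₂) + det Q₁`, `c₃ = pol(P,Q₃) + pol(Q₁,Q₂)`; separated points `z_j` of exact orders `m_j ∈ {1,2,3}`
for `c₀` with `Σ m_j ≥ 20`; persistence `c₁(z_j) = 0` at every multiple zero and `c₁′(z_j) = 0 = c₂(z_j)` at every triple zero; per zero, `m_j + 1`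
non-zero witnesses `σ_{j,0} < … < σ_{j,m_j}` at which the scaling polynomial — `c₀′(z)σ` (simple), `(c₀″(z)/2)σ² + c₁′(z)σ + c₂(z)` (touch),
`(c₀‴(z)/6)σ³ + (c₁″(z)/2)σ² + c₂′(z)σ + c₃(z)` (triple) — takes alternating signs `ε_{j,i}`.  Then `δ ∈ TwentyLocus`. [this work] -/
theorem mem_twentyLocus_of_secondOrder_openings (δ : Fin 6 → ℝ) (S T₁ T₂ T₃ : Fin 6 → Matrix (Fin 2) (Fin 2) ℝ)
    (hS : ∀ l, (S l).IsSymm) (hT₁ : ∀ l, (T₁ l).IsSymm) (hT₂ : ∀ l, (T₂ l).IsSymm) (hT₃ : ∀ l, (T₃ l).IsSymm)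
    {r : ℕ} (z : Fin r → ℝ) {ρ : ℝ} (hρ : 0 < ρ) (hsep : ∀ i j : Fin r, i < j → z i + ρ ≤ z j - ρ)
    (m : Fin r → ℕ) (hm1 : ∀ j, 1 ≤ m j) (hm3 : ∀ j, m j ≤ 3) (hm : 20 ≤ ∑ j, m j)
    (hvan : ∀ j, ∀ i < m j, iteratedDeriv i (fun t => (∑ l, Real.exp (δ l * t) • S l).det) (z j) = 0)
    (hc1 : ∀ j, 2 ≤ m j →
      ((∑ l, Real.exp (δ l * z j) • S l) + (∑ l, Real.exp (δ l * z j) • T₁ l)).det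
        - (∑ l, Real.exp (δ l * z j) • S l).det - (∑ l, Real.exp (δ l * z j) • T₁ l).det = 0)
    (hc1' : ∀ j, m j = 3 → deriv (fun t => ((∑ l, Real.exp (δ l * t) • S l) + (∑ l, Real.exp (δ l * t) • T₁ l)).det
        - (∑ l, Real.exp (δ l * t) • S l).det - (∑ l, Real.exp (δ l * t) • T₁ l).det) (z j) = 0)
    (hc2 : ∀ j, m j = 3 →
      (((∑ l, Real.exp (δ l * z j) • S l) + (∑ l, Real.exp (δ l * z j) • T₂ l)).det
        - (∑ l, Real.exp (δ l * z j) • S l).det - (∑ l, Real.exp (δ l * z j) • T₂ l).det)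
        + (∑ l, Real.exp (δ l * z j) • T₁ l).det = 0)
    (σ : (j : Fin r) → Fin (m j + 1) → ℝ) (hσ : ∀ j, StrictMono (σ j)) (hσ0 : ∀ j i, σ j i ≠ 0)
    (ε : (j : Fin r) → Fin (m j + 1) → ℝ) (hεalt : ∀ j (i : Fin (m j)), ε j i.castSucc * ε j i.succ < 0)
    (hM : ∀ j i, 0 < ε j i *
      (if m j = 1 then deriv (fun t => (∑ l, Real.exp (δ l * t) • S l).det) (z j) * σ j i
       else if m j = 2 then
        iteratedDeriv 2 (fun t => (∑ l, Real.exp (δ l * t) • S l).det) (z j) / 2 * σ j i ^ 2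
        + deriv (fun t => ((∑ l, Real.exp (δ l * t) • S l) + (∑ l, Real.exp (δ l * t) • T₁ l)).det
            - (∑ l, Real.exp (δ l * t) • S l).det - (∑ l, Real.exp (δ l * t) • T₁ l).det) (z j) * σ j i
        + ((((∑ l, Real.exp (δ l * z j) • S l) + (∑ l, Real.exp (δ l * z j) • T₂ l)).det
            - (∑ l, Real.exp (δ l * z j) • S l).det - (∑ l, Real.exp (δ l * z j) • T₂ l).det)
            + (∑ l, Real.exp (δ l * z j) • T₁ l).det)
       else
        iteratedDeriv 3 (fun t => (∑ l, Real.exp (δ l * t) • S l).det) (z j) / 6 * σ j i ^ 3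
        + iteratedDeriv 2 (fun t => ((∑ l, Real.exp (δ l * t) • S l) + (∑ l, Real.exp (δ l * t) • T₁ l)).det
            - (∑ l, Real.exp (δ l * t) • S l).det - (∑ l, Real.exp (δ l * t) • T₁ l).det) (z j) / 2 * σ j i ^ 2
        + deriv (fun t => (((∑ l, Real.exp (δ l * t) • S l) + (∑ l, Real.exp (δ l * t) • T₂ l)).det
            - (∑ l, Real.exp (δ l * t) • S l).det - (∑ l, Real.exp (δ l * t) • T₂ l).det)
            + (∑ l, Real.exp (δ l * t) • T₁ l).det) (z j) * σ j i
        + ((((∑ l, Real.exp (δ l * z j) • S l) + (∑ l, Real.exp (δ l * z j) • T₃ l)).det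
            - (∑ l, Real.exp (δ l * z j) • S l).det - (∑ l, Real.exp (δ l * z j) • T₃ l).det)
          + (((∑ l, Real.exp (δ l * z j) • T₁ l) + (∑ l, Real.exp (δ l * z j) • T₂ l)).det
            - (∑ l, Real.exp (δ l * z j) • T₁ l).det - (∑ l, Real.exp (δ l * z j) • T₂ l).det)))) :
    δ ∈ TwentyLocus := by
  classical
  -- pencils and coefficient functions
  set P : ℝ → Matrix (Fin 2) (Fin 2) ℝ := fun t => ∑ l, Real.exp (δ l * t) • S l with hP
  set Q₁ : ℝ → Matrix (Fin 2) (Fin 2) ℝ := fun t => ∑ l, Real.exp (δ l * t) • T₁ l with hQ₁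
  set Q₂ : ℝ → Matrix (Fin 2) (Fin 2) ℝ := fun t => ∑ l, Real.exp (δ l * t) • T₂ l with hQ₂
  set Q₃ : ℝ → Matrix (Fin 2) (Fin 2) ℝ := fun t => ∑ l, Real.exp (δ l * t) • T₃ l with hQ₃
  set c₀ : ℝ → ℝ := fun t => (P t).det with hc₀
  set c₁ : ℝ → ℝ := fun t => (P t + Q₁ t).det - (P t).det - (Q₁ t).det with hc₁
  set c₂ : ℝ → ℝ := fun t => ((P t + Q₂ t).det - (P t).det - (Q₂ t).det) + (Q₁ t).det with hc₂
  set c₃ : ℝ → ℝ := fun t => ((P t + Q₃ t).det - (P t).det - (Q₃ t).det) + ((Q₁ t + Q₂ t).det - (Q₁ t).det - (Q₂ t).det) with hc₃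
  set c₄ : ℝ → ℝ := fun t => ((Q₁ t + Q₃ t).det - (Q₁ t).det - (Q₃ t).det) + (Q₂ t).det with hc₄
  set c₅ : ℝ → ℝ := fun t => (Q₂ t + Q₃ t).det - (Q₂ t).det - (Q₃ t).det with hc₅
  set c₆ : ℝ → ℝ := fun t => (Q₃ t).det with hc₆
  -- the family and its determinant
  let Sη : ℝ → Fin 6 → Matrix (Fin 2) (Fin 2) ℝ := fun η l => S l + η • T₁ l + η ^ 2 • T₂ l + η ^ 3 • T₃ l
  have hSη : ∀ η l, (Sη η l).IsSymm :=
    fun η l => (((hS l).add ((hT₁ l).smul η)).add ((hT₂ l).smul (η ^ 2))).add ((hT₃ l).smul (η ^ 3))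
  have hdet : ∀ η t, (∑ l, Real.exp (δ l * t) • Sη η l).det
      = c₀ t + η * c₁ t + η ^ 2 * c₂ t + η ^ 3 * c₃ t + η ^ 4 * c₄ t + η ^ 5 * c₅ t + η ^ 6 * c₆ t := by
    intro η t
    show (∑ l, Real.exp (δ l * t) • (S l + η • T₁ l + η ^ 2 • T₂ l + η ^ 3 • T₃ l)).det = _
    rw [expPencil_add_smul3, det_add_smul3_fin_two]
  -- exponential-sum representations
  let ι := Equiv.Perm (Fin 2) × (Fin 2 → Fin 6)
  let x : ι → ℝ := fun p => ∑ i, δ (p.2 i)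
  let lb : (Fin 6 → Matrix (Fin 2) (Fin 2) ℝ) → ι → ℝ := fun U p => ((Equiv.Perm.sign p.1 : ℤ) : ℝ) * ∏ i, U (p.2 i) (p.1 i) i
  have ev : ∀ (U : Fin 6 → Matrix (Fin 2) (Fin 2) ℝ) (t : ℝ), (∑ l, Real.exp (δ l * t) • U l).det = expSum (lb U) x t :=
    fun U t => congrFun (det_expPencil_eq_expSum_fun δ U) t
  have hPQ : ∀ (U V : Fin 6 → Matrix (Fin 2) (Fin 2) ℝ) (t : ℝ),
      (∑ l, Real.exp (δ l * t) • U l) + (∑ l, Real.exp (δ l * t) • V l) = ∑ l, Real.exp (δ l * t) • (U l + V l) :=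
    fun U V t => expPencil_add δ U V t
  let a0 : ι → ℝ := lb S
  let a1 : ι → ℝ := fun p => lb (fun l => S l + T₁ l) p - lb S p - lb T₁ p
  let a2 : ι → ℝ := fun p => (lb (fun l => S l + T₂ l) p - lb S p - lb T₂ p) + lb T₁ p
  let a3 : ι → ℝ := fun p => (lb (fun l => S l + T₃ l) p - lb S p - lb T₃ p) + (lb (fun l => T₁ l + T₂ l) p - lb T₁ p - lb T₂ p)
  let a4 : ι → ℝ := fun p => (lb (fun l => T₁ l + T₃ l) p - lb T₁ p - lb T₃ p) + lb T₂ p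
  let a5 : ι → ℝ := fun p => lb (fun l => T₂ l + T₃ l) p - lb T₂ p - lb T₃ p
  let a6 : ι → ℝ := lb T₃
  have hc₀f : c₀ = expSum a0 x := funext fun t => ev S t
  have hc₁f : c₁ = expSum a1 x := by
    funext t
    show (P t + Q₁ t).det - (P t).det - (Q₁ t).det = _
    rw [hP, hQ₁]; dsimp only
    rw [hPQ, ev, ev, ev, expSum_sub_sub]
  have hc₂f : c₂ = expSum a2 x := by
    funext t
    show ((P t + Q₂ t).det - (P t).det - (Q₂ t).det) + (Q₁ t).det = _
    rw [hP, hQ₁, hQ₂]; dsimp only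
    rw [hPQ, ev, ev, ev, ev, expSum_sub_sub, expSum_add_coeff]
  have hc₃f : c₃ = expSum a3 x := by
    funext t
    show ((P t + Q₃ t).det - (P t).det - (Q₃ t).det) + ((Q₁ t + Q₂ t).det - (Q₁ t).det - (Q₂ t).det) = _
    rw [hP, hQ₁, hQ₂, hQ₃]; dsimp only
    rw [hPQ, hPQ, ev, ev, ev, ev, ev, ev, expSum_sub_sub, expSum_sub_sub, expSum_add_coeff]
  have hc₄f : c₄ = expSum a4 x := by
    funext t
    show ((Q₁ t + Q₃ t).det - (Q₁ t).det - (Q₃ t).det) + (Q₂ t).det = _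
    rw [hQ₁, hQ₂, hQ₃]; dsimp only
    rw [hPQ, ev, ev, ev, ev, expSum_sub_sub, expSum_add_coeff]
  have hc₅f : c₅ = expSum a5 x := by
    funext t
    show (Q₂ t + Q₃ t).det - (Q₂ t).det - (Q₃ t).det = _
    rw [hQ₂, hQ₃]; dsimp only
    rw [hPQ, ev, ev, ev, expSum_sub_sub]
  have hc₆f : c₆ = expSum a6 x := funext fun t => ev T₃ t
  -- the coefficient family on `Fin 7`
  let c : Fin 7 → ι → ℝ := ![a0, a1, a2, a3, a4, a5, a6]
  have hcf : (![c₀, c₁, c₂, c₃, c₄, c₅, c₆] : Fin 7 → ℝ → ℝ) = fun n => expSum (c n) x := by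
    funext n
    fin_cases n
    · exact hc₀f
    · exact hc₁f
    · exact hc₂f
    · exact hc₃f
    · exact hc₄f
    · exact hc₅f
    · exact hc₆f
  have hcn : ∀ n : Fin 7, expSum (c n) x = (![c₀, c₁, c₂, c₃, c₄, c₅, c₆] : Fin 7 → ℝ → ℝ) n := fun n => (congrFun hcf n).symm
  have hF : ∀ η t, (∑ l, Real.exp (δ l * t) • Sη η l).det = ∑ n : Fin 7, η ^ (n : ℕ) * expSum (c n) x t := by
    intro η t
    rw [hdet, Fin.sum_univ_seven]
    simp only [hcn]
    simp only [Matrix.cons_val_zero, Matrix.cons_val_one, Matrix.head_cons, Matrix.cons_val_two, Matrix.tail_cons,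
      Matrix.cons_val_three, Matrix.cons_val_four, Matrix.cons_val, Fin.val_zero, Fin.val_one, Fin.val_two, pow_zero, one_mul, pow_one]
    norm_num
  -- Newton data: `α_j = 1` (`1/2` at simple zeros), `β_j = m_j` (`1/2`), `k_{j,n} = m_j − n`
  refine mem_twentyLocus_of_newton_openings δ Sη hSη c x hF z hρ hsep m hm
    (fun j => if m j = 1 then 1 / 2 else 1) (fun j => by split_ifs <;> norm_num)
    (fun j => if m j = 1 then 1 / 2 else (m j : ℝ)) (fun j n => m j - (n : ℕ)) ?_ ?_ σ hσ hσ0 ε hεalt ?_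
  · -- vanishing below the orders
    intro j n i hi
    rw [hcn]
    have h3 := hm3 j
    fin_cases n
    · change i < m j - 0 at hi
      change iteratedDeriv i c₀ (z j) = 0
      exact hvan j i (by omega)
    · change i < m j - 1 at hi
      change iteratedDeriv i c₁ (z j) = 0
      have hi2 : i < 2 := by omega
      interval_cases i
      · rw [iteratedDeriv_zero]; exact hc1 j (by omega)
      · rw [iteratedDeriv_one]; exact hc1' j (by omega)
    · change i < m j - 2 at hi
      change iteratedDeriv i c₂ (z j) = 0
      have hi0 : i = 0 := by omega
      subst hi0
      rw [iteratedDeriv_zero]; exact hc2 j (by omega)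
    · change i < m j - 3 at hi
      exfalso; omega
    · change i < m j - 4 at hi
      exfalso; omega
    · change i < m j - 5 at hi
      exfalso; omega
    · change i < m j - 6 at hi
      exfalso; omega
  · -- weights
    intro j n
    have h1 := hm1 j; have h3 := hm3 j
    by_cases hj : m j = 1
    · simp only [hj, if_true]
      have : (0 : ℝ) ≤ ((1 - (n : ℕ) : ℕ) : ℝ) := Nat.cast_nonneg _
      have hn : (0 : ℝ) ≤ ((n : ℕ) : ℝ) := Nat.cast_nonneg _
      rcases Nat.eq_zero_or_pos (n : ℕ) with h0 | hpos
      · rw [h0]; norm_num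
      · have : (1 : ℝ) ≤ ((n : ℕ) : ℝ) := by exact_mod_cast hpos
        nlinarith
    · simp only [hj, if_false, one_mul]
      have hsub : ((m j - (n : ℕ) : ℕ) : ℝ) ≥ (m j : ℝ) - ((n : ℕ) : ℝ) := by
        rcases le_or_gt (n : ℕ) (m j) with h | h
        · rw [Nat.cast_sub h]
        · have : ((m j - (n : ℕ) : ℕ) : ℝ) = 0 := by rw [Nat.sub_eq_zero_of_le h.le]; simp
          rw [this]
          have : (m j : ℝ) < ((n : ℕ) : ℝ) := by exact_mod_cast h
          linarith
      linarith
  · -- the scaling polynomials: the abstract sum is the explicit polynomial of the zero's type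
    intro j i
    have h1 := hm1 j; have h3 := hm3 j
    convert hM j i using 2
    rw [Fin.sum_univ_seven]
    simp only [hcn, Matrix.cons_val_zero, Matrix.cons_val_one, Matrix.head_cons, Matrix.cons_val_two, Matrix.tail_cons,
      Matrix.cons_val_three, Matrix.cons_val_four, Matrix.cons_val, Fin.val_zero, Fin.val_one, Fin.val_two]
    rcases (by omega : m j = 1 ∨ m j = 2 ∨ m j = 3) with h | h | h
    · simp only [h]
      norm_num
    · simp only [h]
      norm_num [Nat.factorial]
      rfl
    · simp only [h]
      norm_num [Nat.factorial]
      rfl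

end Summit.ValiantsHypothesis.ValiantsHypothesis.Theorems.LacunarySymmetroidMatrixDescartes.WallBubbling
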